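import Summits.CriticalPhenomena.CardyFormulaZ2.Theorems.CardyIKTransportIKLinearTransportStubOneArmDecayGeo

/-!
# Stub `stub_OneArmDecay` (crux stmt-CriticalPhenomena-5076 `CardyIKTransport.IKLinearTransport`, line
# `pinned-diagram-exchange`) — part 2 of 2: peeling from the inside, the registered stub

Theorem-only support file (`--supports stmt-CriticalPhenomena-5076`): proves the registered skeleton stub
`stub_OneArmDecay` (skeleton v15) by name and signature — POLYNOMIAL ONE-ARM DECAY FROM THE RING FAMILY,
with no FKG input: if, for colour `bb`, conditionally on any measurable event determined beyond distance `n`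
of a `w × h` box (`n ≤ w, h ≤ k n`), the colour-`bb` paths from the box stay within distance `n` with
probability `≥ c_k > 0` (uniformly in the pattern `S`), then
`ν_S(some colour-bb path joins the n × n box at (a,b) to sup-distance > R) ≤ C (n/R)^λ`.

* `oad_step_abstract`, `oad_peel` — the abstract peeling: level events `A j`, each measurable, determined
  far from all lower levels, and of conditional probability `≤ q` given any measurable event determined far
  from its level, satisfy `ν(⋂_{j<J} A j) ≤ q^J` (condition successively on the OUTER levels, which are
  determined far from the inner one);
* `oad_arm_bound` — with the level events of part 1 and margins `ms j` (`3 ms j + n + 2 ≤ ms i` for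
  `j < i`), the arm event has probability `≤ (1 - c)^J` once `3 ms j + n ≤ R` for `j < J`;
* `stub_OneArmDecay` — margins `(3^j - 1)(n + 1)`, `J = ⌊log₃ (R/(n+1))⌋`, `c` shrunk to `≤ 1/2`,
  `λ = -log(1-c)/log 3`, `C = 6^λ`.
-/

noncomputable section

namespace Summit.CriticalPhenomena.CardyFormulaZ2.Theorems.IKLinearTransport.PinnedDiagramExchange

open scoped BigOperators Topology Classical MeasureTheory ProbabilityTheory ENNReal symmDiff
open Filter Set Function MeasureTheory
open Literature.Probability.Percolation Literature.Probability.LatticeModels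
open Literature.Probability.RandomPlanarGeometry

/-! ## §1 Peeling the levels from the inside -/

/-- ONE PEELING STEP, abstractly: if `L` misses `C` and `c ν(E) ≤ ν(E ∩ C)`, then
`ν(L ∩ E) ≤ (1 - c) ν(E)`. [folklore] -/
theorem oad_step_abstract {ν : Measure Obs} [IsFiniteMeasure ν] {c : ℝ} {L C E : Set Obs}
    (hLE : MeasurableSet (L ∩ E)) (hLC : ∀ x ∈ L, x ∉ C) (hH : c * ν.real E ≤ ν.real (E ∩ C)) :
    ν.real (L ∩ E) ≤ (1 - c) * ν.real E := by
  have hdisj : Disjoint (E ∩ C) (L ∩ E) :=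
    Set.disjoint_left.2 fun x hx hx' => hLC x hx'.1 hx.2
  have hle : ν.real (E ∩ C) + ν.real (L ∩ E) ≤ ν.real E := by
    rw [← measureReal_union hdisj hLE]
    exact measureReal_mono (Set.union_subset Set.inter_subset_left Set.inter_subset_right)
  linarith

/-- PEELING, abstractly: level events `A j`, measurable, each determined far from all lower levels, and
each of conditional probability `≤ q` given any measurable event determined far from its level, have
`ν(⋂_{j ≤ i < j+k} A i) ≤ q ^ k`. [folklore] -/
theorem oad_peel (ν : Measure Obs) [IsProbabilityMeasure ν] {q : ℝ} (hq : 0 ≤ q) (A : ℕ → Set Obs)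
    (Far : ℕ → Set (Site 2)) (hmeas : ∀ j, MeasurableSet (A j))
    (hdet : ∀ i j, j < i → A i ∈ determinedOn (Far j))
    (hstep : ∀ (j : ℕ) (E : Set Obs), MeasurableSet E → E ∈ determinedOn (Far j) →
      ν.real (A j ∩ E) ≤ q * ν.real E) :
    ∀ k j : ℕ, ν.real (⋂ i ∈ Finset.Ico j (j + k), A i) ≤ q ^ k := by
  intro k
  induction k with
  | zero =>
    intro j
    simp
  | succ k ih =>
    intro j
    have hsub : (⋂ i ∈ Finset.Ico j (j + (k + 1)), A i) ⊆
        A j ∩ ⋂ i ∈ Finset.Ico (j + 1) (j + 1 + k), A i := by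
      intro x hx
      simp only [Set.mem_iInter, Finset.mem_Ico, Set.mem_inter_iff] at hx ⊢
      exact ⟨hx j ⟨le_rfl, by omega⟩, fun i hi => hx i ⟨by omega, by omega⟩⟩
    have hEm : MeasurableSet (⋂ i ∈ Finset.Ico (j + 1) (j + 1 + k), A i) :=
      Finset.measurableSet_biInter _ fun i _ => hmeas i
    have hEd : (⋂ i ∈ Finset.Ico (j + 1) (j + 1 + k), A i) ∈ determinedOn (Far j) := by
      intro x y hxy
      simp only [Set.mem_iInter]
      exact forall₂_congr fun i hi => hdet i j (by rw [Finset.mem_Ico] at hi; omega) x y hxy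
    calc ν.real (⋂ i ∈ Finset.Ico j (j + (k + 1)), A i)
        ≤ ν.real (A j ∩ ⋂ i ∈ Finset.Ico (j + 1) (j + 1 + k), A i) := measureReal_mono hsub
      _ ≤ q * ν.real (⋂ i ∈ Finset.Ico (j + 1) (j + 1 + k), A i) := hstep j _ hEm hEd
      _ ≤ q * q ^ k := mul_le_mul_of_nonneg_left (ih (j + 1)) hq
      _ = q ^ (k + 1) := by ring

/-- THE ARM BOUND IN GEOMETRIC FORM: given the ring family of colour `bb` (constant `c ≤ 1`) for the nested
squares around the `n × n` box at `(a, b)` and margins `ms j` with `3 ms j + n + 2 ≤ ms i` (`j < i`), the arm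
event to distance `R` has probability `≤ (1 - c) ^ J` whenever the `J` first levels fit (`3 ms j + n ≤ R`).
[folklore] -/
theorem oad_arm_bound (bb : Bool) {c : ℝ} (hc1 : c ≤ 1) (S : Set ℤ) (n : ℕ) (a b : ℤ)
    (hH : ∀ (m : ℕ) (E : Set Obs), MeasurableSet E →
      E ∈ determinedOn (farFrom (a - m) (b - m) (n + 2 * m) (n + 2 * m) (n + 2 * m)) →
      c * (νmix S).real E ≤ (νmix S).real (E ∩ {x : Obs | ∀ p ∈ monoPaths x bb,
        (∃ u ∈ p, a - m ≤ u 0 ∧ u 0 < a - m + (n + 2 * m : ℕ) ∧ b - m ≤ u 1 ∧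
          u 1 < b - m + (n + 2 * m : ℕ)) →
        ∀ v ∈ p, v ∉ farFrom (a - m) (b - m) (n + 2 * m) (n + 2 * m) (n + 2 * m)}))
    (ms : ℕ → ℕ) (hms : ∀ i j, j < i → 3 * ms j + n + 2 ≤ ms i) (J R : ℕ)
    (hR : ∀ j, j < J → 3 * ms j + n ≤ R) :
    (νmix S).real {x | ∃ p ∈ monoPaths x bb, (∃ u ∈ p, a ≤ u 0 ∧ u 0 < a + n ∧ b ≤ u 1 ∧ u 1 < b + n) ∧
        ∃ v ∈ p, v ∈ farFrom a b n n R} ≤ (1 - c) ^ J := by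
  haveI : IsProbabilityMeasure (νmix S) := isProbabilityMeasure_nuMix S
  have key := oad_peel (νmix S) (q := 1 - c) (by linarith)
    (fun j => {x : Obs | ∃ p ∈ monoPaths x bb,
      (∀ z ∈ p, (a - n - 3 * ms j - 1 ≤ z 0 ∧ z 0 ≤ a + 2 * n + 3 * ms j ∧
          b - n - 3 * ms j - 1 ≤ z 1 ∧ z 1 ≤ b + 2 * n + 3 * ms j) ∧
        ¬ (a - ms j + 1 ≤ z 0 ∧ z 0 < a + n + ms j - 1 ∧ b - ms j + 1 ≤ z 1 ∧ z 1 < b + n + ms j - 1)) ∧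
      (∃ u ∈ p, a - ms j ≤ u 0 ∧ u 0 < a + n + ms j ∧ b - ms j ≤ u 1 ∧ u 1 < b + n + ms j) ∧
      ∃ v ∈ p, v ∈ farFrom (a - ms j) (b - ms j) (n + 2 * ms j) (n + 2 * ms j) (n + 2 * ms j)})
    (fun j => farFrom (a - ms j) (b - ms j) (n + 2 * ms j) (n + 2 * ms j) (n + 2 * ms j))
    (fun j => oad_level_measurableSet bb a b n (ms j))
    (fun i j hij => oad_level_mem_determinedOn_far bb a b n (ms j) (ms i) (hms i j hij))
    (fun j E hE hdet => oad_step_abstract ((oad_level_measurableSet bb a b n (ms j)).inter hE)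
      (oad_level_not_conf bb a b n (ms j)) (hH (ms j) E hE hdet)) J 0
  refine (measureReal_mono fun x hx => Set.mem_iInter₂.2 fun i hi => ?_).trans key
  have hi' : i < J := by
    have := (Finset.mem_Ico.1 hi).2
    omega
  exact oad_arm_subset_level bb a b n (ms i) R (hR i hi') x hx

/-! ## §2 The margins `(3^j - 1)(n + 1)` and the registered stub -/

/-- The margins `m_j = (3^j - 1)(n + 1)` are nested: `3 m_j + n + 2 ≤ m_i` for `j < i`. [folklore] -/
theorem oad_ms_growth (n : ℕ) {i j : ℕ} (hij : j < i) :
    3 * ((3 ^ j - 1) * (n + 1)) + n + 2 ≤ (3 ^ i - 1) * (n + 1) := by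
  have h1 : 3 ^ (j + 1) ≤ 3 ^ i := Nat.pow_le_pow_right (by norm_num) hij
  rw [pow_succ] at h1
  obtain ⟨X, hX⟩ : ∃ X, 3 ^ j = X + 1 := ⟨3 ^ j - 1, by have := Nat.one_le_pow j 3 (by norm_num); omega⟩
  obtain ⟨Y, hY⟩ : ∃ Y, 3 ^ i = Y + 1 := ⟨3 ^ i - 1, by have := Nat.one_le_pow i 3 (by norm_num); omega⟩
  rw [hX, hY] at h1
  rw [hX, hY]
  simp only [Nat.add_sub_cancel]
  have h2 := Nat.mul_le_mul_right (n + 1) h1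
  nlinarith

/-- The `J` first levels fit below distance `R` as soon as `3^J (n + 1) ≤ R`. [folklore] -/
theorem oad_ms_reach (n : ℕ) {j J R : ℕ} (hj : j < J) (hR : 3 ^ J * (n + 1) ≤ R) :
    3 * ((3 ^ j - 1) * (n + 1)) + n ≤ R := by
  have h1 : 3 ^ (j + 1) ≤ 3 ^ J := Nat.pow_le_pow_right (by norm_num) hj
  rw [pow_succ] at h1
  obtain ⟨X, hX⟩ : ∃ X, 3 ^ j = X + 1 := ⟨3 ^ j - 1, by have := Nat.one_le_pow j 3 (by norm_num); omega⟩
  rw [hX] at h1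
  rw [hX]
  simp only [Nat.add_sub_cancel]
  have h2 := Nat.mul_le_mul_right (n + 1) h1
  nlinarith

/-- **STUB `stub_OneArmDecay` (skeleton v15) · POLYNOMIAL ONE-ARM DECAY FROM THE RING FAMILY.** If, for
colour `bb`, every box conditioned on any measurable far event confines the colour-`bb` cluster of the box
within the conditioning distance with probability `≥ c_k > 0` (uniformly in the pattern `S`, the scale and
the aspect ratio `≤ k`), then the probability that some colour-`bb` path joins the `n × n` box at `(a, b)` to
sup-distance `> R` is `≤ C (n/R)^λ`, uniformly in `S`. Proof: nested squares `[a-m_j, a+n+m_j)²`,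
`m_j = (3^j - 1)(n+1)`, each conditioned at distance its side; the arm event lies in every level event
(annular witnesses, `oad_arm_subset_level`), level `i` is determined far from every level `j < i`
(`oad_level_mem_determinedOn_far`), so peeling from the inside with the family at `k = 1` costs a factor
`1 - c` per level (`oad_peel`); `J = ⌊log₃ (R/(n+1))⌋` levels fit, and `(1-c)^J ≤ 6^λ (n/R)^λ` with
`λ = -log (1-c) / log 3` (after shrinking `c` to `≤ 1/2`). [folklore] -/
theorem stub_OneArmDecay : ∀ bb : Bool,
    (∀ k : ℕ, ∃ c : ℝ, 0 < c ∧ ∀ (S : Set ℤ) (n : ℕ), 1 ≤ n → ∀ (a b : ℤ) (w h : ℕ),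
        n ≤ w → w ≤ k * n → n ≤ h → h ≤ k * n → ∀ E : Set Obs, MeasurableSet E →
        E ∈ determinedOn (farFrom a b w h n) →
        c * (νmix S).real E ≤ (νmix S).real (E ∩ {x | ∀ p ∈ monoPaths x bb,
          (∃ u ∈ p, a ≤ u 0 ∧ u 0 < a + w ∧ b ≤ u 1 ∧ u 1 < b + h) → ∀ v ∈ p, v ∉ farFrom a b w h n})) →
    ∃ C lam : ℝ, 0 < lam ∧ ∀ (S : Set ℤ) (n : ℕ), 1 ≤ n → ∀ R : ℕ, n ≤ R → ∀ (a b : ℤ),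
      (νmix S).real {x | ∃ p ∈ monoPaths x bb,
          (∃ u ∈ p, a ≤ u 0 ∧ u 0 < a + n ∧ b ≤ u 1 ∧ u 1 < b + n) ∧ ∃ v ∈ p, v ∈ farFrom a b n n R} ≤
        C * ((n : ℝ) / R) ^ lam := by
  intro bb hfam
  obtain ⟨c, hc, hHc⟩ := hfam 1
  -- the effective constant `c' = min c (1/2)`, the ratio `q = 1 - c'` and the exponent
  set c' : ℝ := min c (1 / 2) with hc'def
  have hc'0 : 0 < c' := lt_min hc one_half_pos
  have hc'le : c' ≤ 1 / 2 := min_le_right _ _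
  have hc'c : c' ≤ c := min_le_left _ _
  set q : ℝ := 1 - c' with hqdef
  have hq0 : 0 < q := by linarith
  have hq1 : q < 1 := by linarith
  have hlogq : Real.log q < 0 := Real.log_neg hq0 hq1
  have hlog3 : 0 < Real.log 3 := Real.log_pos (by norm_num)
  set lam : ℝ := -Real.log q / Real.log 3 with hlamdef
  have hlam : 0 < lam := div_pos (by linarith) hlog3
  refine ⟨(6 : ℝ) ^ lam, lam, hlam, fun S n hn R hnR a b => ?_⟩
  haveI : IsProbabilityMeasure (νmix S) := isProbabilityMeasure_nuMix S
  -- the ring family at aspect bound `1` for the nested squares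
  have hH : ∀ (m : ℕ) (E : Set Obs), MeasurableSet E →
      E ∈ determinedOn (farFrom (a - m) (b - m) (n + 2 * m) (n + 2 * m) (n + 2 * m)) →
      c' * (νmix S).real E ≤ (νmix S).real (E ∩ {x : Obs | ∀ p ∈ monoPaths x bb,
        (∃ u ∈ p, a - m ≤ u 0 ∧ u 0 < a - m + (n + 2 * m : ℕ) ∧ b - m ≤ u 1 ∧
          u 1 < b - m + (n + 2 * m : ℕ)) →
        ∀ v ∈ p, v ∉ farFrom (a - m) (b - m) (n + 2 * m) (n + 2 * m) (n + 2 * m)}) :=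
    fun m E hE hdet => (mul_le_mul_of_nonneg_right hc'c measureReal_nonneg).trans
      (hHc S (n + 2 * m) (by omega) (a - m) (b - m) (n + 2 * m) (n + 2 * m) le_rfl (by omega) le_rfl
        (by omega) E hE hdet)
  -- the number of levels `J = ⌊log₃ (R / (n+1))⌋` and the geometric bound `q ^ J`
  set J : ℕ := Nat.log 3 (R / (n + 1)) with hJdef
  have hbound : (νmix S).real {x | ∃ p ∈ monoPaths x bb,
      (∃ u ∈ p, a ≤ u 0 ∧ u 0 < a + n ∧ b ≤ u 1 ∧ u 1 < b + n) ∧ ∃ v ∈ p, v ∈ farFrom a b n n R} ≤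
      q ^ J := by
    rcases Nat.eq_zero_or_pos (R / (n + 1)) with h0 | hpos
    · have hJ0 : J = 0 := by rw [hJdef, h0, Nat.log_zero_right]
      rw [hJ0, pow_zero]
      exact measureReal_le_one
    · have hJR : 3 ^ J * (n + 1) ≤ R :=
        (Nat.le_div_iff_mul_le (Nat.succ_pos n)).1 (Nat.pow_log_le_self 3 (Nat.pos_iff_ne_zero.1 hpos))
      exact oad_arm_bound bb (by linarith) S n a b hH (fun j => (3 ^ j - 1) * (n + 1))
        (fun i j hij => oad_ms_growth n hij) J R (fun j hj => oad_ms_reach n hj hJR)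
  -- conversion: `R < 3^(J+1) (n+1) ≤ 6 n 3^J`, so `q ^ J = (3^J)^{-λ} ≤ (6n/R)^λ`
  have hRlt : R < 3 ^ (J + 1) * (n + 1) :=
    (Nat.div_lt_iff_lt_mul (Nat.succ_pos n)).1 (Nat.lt_pow_succ_log_self (by norm_num) _)
  have hn1 : (1 : ℝ) ≤ n := by exact_mod_cast hn
  have hR0 : (0 : ℝ) < R := by
    have : (1 : ℝ) ≤ R := by exact_mod_cast hn.trans hnR
    linarith
  have h3J : (0 : ℝ) < 3 ^ J := pow_pos (by norm_num) J
  have hR6 : (R : ℝ) ≤ 6 * n * 3 ^ J := by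
    have h : (R : ℝ) < 3 ^ (J + 1) * (n + 1) := by exact_mod_cast hRlt
    rw [pow_succ] at h
    nlinarith
  have hinv : ((3 : ℝ) ^ J)⁻¹ ≤ 6 * ((n : ℝ) / R) := by
    rw [mul_div_assoc', inv_eq_one_div, div_le_div_iff₀ h3J hR0]
    linarith
  have hqJ : q ^ J = ((3 : ℝ) ^ J)⁻¹ ^ lam := by
    rw [Real.rpow_def_of_pos (inv_pos.2 h3J), Real.log_inv, Real.log_pow]
    have h : -(↑J * Real.log 3) * lam = ↑J * Real.log q := by
      rw [hlamdef]
      field_simp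
    rw [h, Real.exp_nat_mul, Real.exp_log hq0]
  calc (νmix S).real {x | ∃ p ∈ monoPaths x bb,
          (∃ u ∈ p, a ≤ u 0 ∧ u 0 < a + n ∧ b ≤ u 1 ∧ u 1 < b + n) ∧ ∃ v ∈ p, v ∈ farFrom a b n n R}
      ≤ q ^ J := hbound
    _ = ((3 : ℝ) ^ J)⁻¹ ^ lam := hqJ
    _ ≤ (6 * ((n : ℝ) / R)) ^ lam := Real.rpow_le_rpow (inv_nonneg.2 h3J.le) hinv hlam.le
    _ = (6 : ℝ) ^ lam * ((n : ℝ) / R) ^ lam :=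
        Real.mul_rpow (by norm_num) (div_nonneg (Nat.cast_nonneg n) (Nat.cast_nonneg R))

end Summit.CriticalPhenomena.CardyFormulaZ2.Theorems.IKLinearTransport.PinnedDiagramExchange

end
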